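import Summits.QuantumAdvantage.QuantumAdvantage.Theorems.CubicForrelationNearExactIsExactBentDuality
import Summits.QuantumAdvantage.QuantumAdvantage.Theorems.CubicForrelationNearExactIsExactInvariantWeight
import Summits.QuantumAdvantage.QuantumAdvantage.Theorems.CubicForrelationNearExactIsExactLrdrPin
import Literature.Computability.QuantumComplexity.ForrelationDirectSum

/-!
# `NearExactIsExact` (stmt-QuantumAdvantage-14043), line `direct-sum-amplification` — the low-rank dyadic
rigidity band (LB, lead c4)

Stub `stub_lrdrBand` of the line `direct-sum-amplification` for the crux
`Summit.QuantumAdvantage.QuantumAdvantage.Theses.CubicForrelation.NearExactIsExact` (crux idea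
`low-rank-dyadic-rigidity`, ideator 2, made a tree theorem).

**What.** For cubic `f`, cubic BENT `g` on `m + m` bits (`W_g² ≡ 2^{m+m}`) and `f`
`(j,k)`-LOW-RANK-SPANNED — there is an xor-closed `V ∋ 0` with `2^{m+m} ≤ 2^k |V|` every element of which lies in
the xor-span of the directions `u` whose row of the derivative Walsh table `T_f(u,·)` has all its nonzero entries
of square `≥ 4^{m+m−j}` (for cubic `f`: the quadratic `D_u f` has symplectic rank `≤ 2j`) —

  `Φ(f,g) = 1 ∨ Φ(f,g) ≤ 1 − 2^{−(j+2)} ∨ Φ(f,g) ≤ 1 − 2^{1−k}`.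

The statement is conditional on six tool statements (all landed for this crux): D (`stub_derivDegree`), QW
(`stub_quadWalshPlateau`), DP (`stub_dyadicPin`), PR (`stub_perturbRow`), IW (`stub_invariantWeight`), LP
(`stub_lrdrPin`); they enter as antecedents exactly as registered in the skeleton.

**Proof.** Let `d` be the dual of `g` (`bb_exists_dual`) and `e = f ⊕ d`, `wt = #{e = 1}`; then
`Φ = 1 − 2·wt/2^{m+m}` (`bb_forrelation_eq_of_dual`). If `Φ ≤ 1 − 2^{−(j+2)}` we are done; otherwise
`4·wt < 2^{m+m−j}/2`. Along a low-rank direction `u`: the row `T_f(u,·)` is the Walsh spectrum of the quadratic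
`D_u f` (D), hence PLATEAUED at an even level `2^s` (QW), and `2^s ≥ 2^{m+m−j}` because the row is not identically
zero (its mass is `4^{m+m}`); the row `T_d(u,·)` is the transposed column of `T_g` (`bb_dwt_transpose_dual`), whose
entries are Walsh values of the quadratics `D_v g` (D), hence DYADIC (QW); and the two rows are uniformly
`4·wt`-close (PR with `a := f`, `e := f ⊕ d`, since `f ⊕ (f ⊕ d) = d`). So LP gives `D_u f ≡ D_u d`, i.e. `e` is
`u`-periodic. Periodicity is preserved under xor (associativity), so by the span's induction principle `e` is
`V`-invariant, and IW gives `|V| ∣ wt`: either `wt = 0` (`Φ = 1`) or `wt ≥ |V| ≥ 2^{m+m−k}` (`Φ ≤ 1 − 2^{1−k}`).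

References (orientation): C. Carlet, Boolean Functions for Cryptography and Coding Theory (2021), §6.1
(duality of bent functions, (6.3)); F. J. MacWilliams, N. J. A. Sloane, The Theory of Error-Correcting Codes
(1977), Ch. 15 §2 (Dickson). Everything used here is proved in the tree.
-/

set_option linter.dupNamespace false -- D-0017: single-problem summit

namespace Summit.QuantumAdvantage.QuantumAdvantage.Theorems.CubicForrelation.NearExactIsExact

open Finset
open Literature.Computability.QuantumComplexity
open Literature.Computability.QuantumComplexity.BuzetChailloux (bxor zeroVec signOf_sq bxor_zeroVec)
open Literature.Computability.QuantumComplexity.DerivativeWalsh (W dwt sum_dwt_sq_of_sq)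

/-- Sign bookkeeping: `(-1)^a (-1)^b = (-1)^c (-1)^{d'}` forces `b ⊕ d' = a ⊕ c`. -/
theorem lb_xor_of_sign_eq (a b c d' : Bool) (h : signOf a * signOf b = signOf c * signOf d') :
    (b ^^ d') = (a ^^ c) := by
  revert h
  cases a <;> cases b <;> cases c <;> cases d' <;> simp [signOf] <;> norm_num

/-- `f ⊕ (f ⊕ d) = d` pointwise. -/
theorem lb_xor_xor_cancel (a b : Bool) : (a ^^ (a ^^ b)) = b := by
  cases a <;> cases b <;> rfl

/-- Row `u` of the derivative table of `(-1)^f` is the Walsh spectrum of the derivative `D_u f`: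
`T_f(u,v) = W_{(-1)^{D_u f}}(v)`. -/
theorem lb_dwt_eq_W_deriv {n : ℕ} (f : (Fin n → Bool) → Bool) (u v : Fin n → Bool) :
    dwt (fun x => signOf (f x)) u v = W (fun x => signOf (f x ^^ f (bxor x u))) v := by
  rw [lrdr_dwt_eq_W]
  refine congrArg (fun F => W F v) (funext fun x => ?_)
  exact (signOf_xor (f x) (f (bxor x u))).symm

/-- `4^x = (2^x)²` in `ℝ`. -/
theorem lb_four_pow (x : ℕ) : (4 : ℝ) ^ x = ((2 : ℝ) ^ x) ^ 2 := by
  rw [← pow_mul, mul_comm, pow_mul]; norm_num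

/-- A row of the derivative table of a `±1` function is not identically zero (its mass is `4ⁿ`). -/
theorem lb_row_ne_zero {n : ℕ} (f : (Fin n → Bool) → Bool) (u : Fin n → Bool) :
    ∃ v, dwt (fun x => signOf (f x)) u v ≠ 0 := by
  by_contra h
  push Not at h
  have hmass := sum_dwt_sq_of_sq (fun x => signOf (f x)) (fun x => signOf_sq (f x)) u
  rw [sum_eq_zero (fun v _ => by rw [h v]; ring)] at hmass
  exact absurd hmass (by positivity)

/-- **stub_lrdrBand** (LB — the low-rank dyadic rigidity band; see the module docstring). -/
theorem stub_lrdrBand :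
    (∀ (n d : ℕ) (e : (Fin n → Bool) → Bool) (t : Fin n → Bool), IsDegLeFun (d + 1) e →
      IsDegLeFun d (fun x => e x ^^ e (bxor x t))) →
    (∀ (n : ℕ) (q : (Fin n → Bool) → Bool), IsDegLeFun 2 q →
      ∃ s : ℕ, ∀ v, W (fun x => signOf (q x)) v = 0 ∨ W (fun x => signOf (q x)) v ^ 2 = (4 : ℝ) ^ s) →
    (∀ (x y : ℝ) (s : ℕ), x ^ 2 = (4 : ℝ) ^ s → (y = 0 ∨ ∃ t : ℕ, y ^ 2 = (4 : ℝ) ^ t) →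
      |y - x| < (2 : ℝ) ^ s / 2 → y = x) →
    (∀ (n : ℕ) (a e : (Fin n → Bool) → Bool) (u v : Fin n → Bool),
      |dwt (fun x => signOf (a x ^^ e x)) u v - dwt (fun x => signOf (a x)) u v| ≤
        4 * ((univ.filter fun x => e x = true).card : ℝ)) →
    (∀ (n : ℕ) (e : (Fin n → Bool) → Bool) (V : Finset (Fin n → Bool)), zeroVec ∈ V →
      (∀ x ∈ V, ∀ y ∈ V, bxor x y ∈ V) → (∀ u ∈ V, ∀ x, e (bxor x u) = e x) →
      V.card ∣ (univ.filter fun x => e x = true).card) →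
    ((∀ (x y : ℝ) (s : ℕ), x ^ 2 = (4 : ℝ) ^ s → (y = 0 ∨ ∃ t : ℕ, y ^ 2 = (4 : ℝ) ^ t) →
        |y - x| < (2 : ℝ) ^ s / 2 → y = x) →
      ∀ (n : ℕ) (A B : (Fin n → Bool) → ℝ) (u : Fin n → Bool) (s : ℕ) (w : ℝ),
        (∀ x, A x ^ 2 = 1) → (∀ x, B x ^ 2 = 1) →
        (∀ v, dwt A u v = 0 ∨ dwt A u v ^ 2 = (4 : ℝ) ^ s) →
        (∀ v, dwt B u v = 0 ∨ ∃ t : ℕ, dwt B u v ^ 2 = (4 : ℝ) ^ t) →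
        (∀ v, |dwt B u v - dwt A u v| ≤ w) → w < (2 : ℝ) ^ s / 2 →
        ∀ x, A x * A (bxor x u) = B x * B (bxor x u)) →
    ∀ (m j k : ℕ) (f g : (Fin (m + m) → Bool) → Bool), IsDegLeFun 3 f → IsDegLeFun 3 g →
      (∀ x, W (fun y => signOf (g y)) x ^ 2 = (2 : ℝ) ^ (m + m)) →
      (∃ V : Finset (Fin (m + m) → Bool), zeroVec ∈ V ∧ (∀ x ∈ V, ∀ y ∈ V, bxor x y ∈ V) ∧
        2 ^ (m + m) ≤ 2 ^ k * V.card ∧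
        ∀ v ∈ V, ∀ P : (Fin (m + m) → Bool) → Prop,
          (∀ u, (∀ w, dwt (fun x => signOf (f x)) u w = 0 ∨
            (4 : ℝ) ^ (m + m) ≤ (4 : ℝ) ^ j * dwt (fun x => signOf (f x)) u w ^ 2) → P u) →
          P zeroVec → (∀ x y, P x → P y → P (bxor x y)) → P v) →
      forrelation f g = 1 ∨ forrelation f g ≤ 1 - (1 / 2) ^ (j + 2) ∨ forrelation f g ≤ 1 - 2 * (1 / 2) ^ k := by
  intro hD hQW hDP hPR hIW hLP m j k f g hf hg hbent hV
  obtain ⟨V, hV0, hVadd, hVcard, hVspan⟩ := hV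
  -- the dual and the distance form of Φ
  obtain ⟨d, hd⟩ := bb_exists_dual hbent
  set e : (Fin (m + m) → Bool) → Bool := fun x => f x ^^ d x with he_def
  set wt : ℕ := (univ.filter fun x => e x = true).card with hwt_def
  have hwt_eq : ((univ.filter fun x => f x ≠ d x).card : ℝ) = wt := by
    rw [hwt_def, he_def, bb_filter_bxor_eq]
  have hΦ : forrelation f g = 1 - 2 * (wt : ℝ) / 2 ^ (m + m) := by
    rw [bb_forrelation_eq_of_dual f g d hd, hwt_eq]
  have h2n : (0 : ℝ) < (2 : ℝ) ^ (m + m) := by positivity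
  -- trichotomy on Φ: only the top range needs work
  by_cases htop : forrelation f g ≤ 1 - (1 / 2) ^ (j + 2)
  · exact Or.inr (Or.inl htop)
  push Not at htop
  -- the weight bound `4·wt < 2^{m+m} (1/2)^j / 2`
  have hwt_lt : 4 * (wt : ℝ) < (2 : ℝ) ^ (m + m) * (1 / 2) ^ j / 2 := by
    rw [hΦ] at htop
    have h1 : 2 * (wt : ℝ) / 2 ^ (m + m) < (1 / 2) ^ (j + 2) := by linarith
    rw [div_lt_iff₀ h2n] at h1
    have h3 : (1 / 2 : ℝ) ^ (j + 2) = (1 / 2) ^ j / 4 := by ring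
    rw [h3] at h1
    linarith [h1]
  -- periodicity along every low-rank direction
  have hper : ∀ u : Fin (m + m) → Bool,
      (∀ w, dwt (fun x => signOf (f x)) u w = 0 ∨
        (4 : ℝ) ^ (m + m) ≤ (4 : ℝ) ^ j * dwt (fun x => signOf (f x)) u w ^ 2) →
      ∀ x, e (bxor x u) = e x := by
    intro u hlow
    -- row u of T_f: plateaued at level s (QW on the quadratic D_u f)
    obtain ⟨s, hs⟩ := hQW (m + m) (fun x => f x ^^ f (bxor x u)) (hD (m + m) 2 f u hf)
    have hplat : ∀ v, dwt (fun x => signOf (f x)) u v = 0 ∨ dwt (fun x => signOf (f x)) u v ^ 2 = (4 : ℝ) ^ s := by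
      intro v; rw [lb_dwt_eq_W_deriv]; exact hs v
    -- the level: 2^{m+m} (1/2)^j ≤ 2^s
    have hlevel : (2 : ℝ) ^ (m + m) * (1 / 2) ^ j ≤ (2 : ℝ) ^ s := by
      obtain ⟨v₀, hv₀⟩ := lb_row_ne_zero f u
      have hsq : dwt (fun x => signOf (f x)) u v₀ ^ 2 = (4 : ℝ) ^ s := (hplat v₀).resolve_left hv₀
      have hle : (4 : ℝ) ^ (m + m) ≤ (4 : ℝ) ^ j * (4 : ℝ) ^ s := by
        have := (hlow v₀).resolve_left hv₀; rwa [hsq] at this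
      rw [lb_four_pow, lb_four_pow, lb_four_pow, ← mul_pow] at hle
      have hle' : (2 : ℝ) ^ (m + m) ≤ (2 : ℝ) ^ j * (2 : ℝ) ^ s :=
        (pow_le_pow_iff_left₀ (by positivity) (by positivity) two_ne_zero).1 hle
      have hj : (0 : ℝ) < (2 : ℝ) ^ j := by positivity
      rw [one_div_pow, mul_one_div, div_le_iff₀ hj, mul_comm]
      exact hle'
    -- row u of T_d: dyadic (transposed column of T_g, whose entries are Walsh values of the quadratics D_v g)
    have hdyad : ∀ v, dwt (fun x => signOf (d x)) u v = 0 ∨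
        ∃ t : ℕ, dwt (fun x => signOf (d x)) u v ^ 2 = (4 : ℝ) ^ t := by
      intro v
      rw [← bb_dwt_transpose_dual hd u v, lb_dwt_eq_W_deriv]
      obtain ⟨t, ht⟩ := hQW (m + m) (fun x => g x ^^ g (bxor x v)) (hD (m + m) 2 g v hg)
      exact (ht u).imp_right fun h => ⟨t, h⟩
    -- closeness of the two rows (PR with a := f, e := f ⊕ d)
    have hclose : ∀ v, |dwt (fun x => signOf (d x)) u v - dwt (fun x => signOf (f x)) u v| ≤ 4 * (wt : ℝ) := by
      intro v
      have h := hPR (m + m) f e u v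
      have hfe : (fun x => signOf (f x ^^ e x)) = fun x => signOf (d x) := by
        funext x; rw [he_def]; exact congrArg signOf (lb_xor_xor_cancel (f x) (d x))
      rwa [hfe] at h
    have hw : 4 * (wt : ℝ) < (2 : ℝ) ^ s / 2 := lt_of_lt_of_le hwt_lt (by linarith [hlevel])
    -- LP: the derivative rows coincide pointwise
    have hLP' := hLP hDP (m + m) (fun x => signOf (f x)) (fun x => signOf (d x)) u s (4 * (wt : ℝ))
      (fun x => signOf_sq (f x)) (fun x => signOf_sq (d x)) hplat hdyad hclose hw
    intro x
    have hx := lb_xor_of_sign_eq _ _ _ _ (hLP' x)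
    -- hx : (f (x⊕u) ⊕ d (x⊕u)) = (f x ⊕ d x)
    simpa [he_def] using hx
  -- invariance under V (span induction) and divisibility of the weight
  have hinv : ∀ v ∈ V, ∀ x, e (bxor x v) = e x := by
    intro v hv
    refine hVspan v hv (fun u => ∀ x, e (bxor x u) = e x) hper (fun x => by rw [bxor_zeroVec]) ?_
    intro a b ha hb x
    rw [← iw_bxor_assoc, hb, ha]
  have hdvd : V.card ∣ wt := hIW (m + m) e V hV0 hVadd hinv
  -- conclude
  rcases Nat.eq_zero_or_pos wt with hwt0 | hwtpos
  · left
    rw [hΦ, hwt0]; simp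
  · right; right
    have hle : V.card ≤ wt := Nat.le_of_dvd hwtpos hdvd
    have hcardR : (2 : ℝ) ^ (m + m) ≤ (2 : ℝ) ^ k * (wt : ℝ) := by
      have h1 : ((2 ^ (m + m) : ℕ) : ℝ) ≤ ((2 ^ k * V.card : ℕ) : ℝ) := by exact_mod_cast hVcard
      push_cast at h1
      have h2 : (V.card : ℝ) ≤ (wt : ℝ) := by exact_mod_cast hle
      have hk : (0 : ℝ) ≤ (2 : ℝ) ^ k := by positivity
      nlinarith
    have hk : (0 : ℝ) < (2 : ℝ) ^ k := by positivity
    have key : (1 / 2 : ℝ) ^ k ≤ (wt : ℝ) / 2 ^ (m + m) := by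
      rw [le_div_iff₀ h2n, one_div_pow, one_div, inv_mul_eq_div, div_le_iff₀ hk, mul_comm (wt : ℝ)]
      exact hcardR
    rw [hΦ]
    have : 2 * (wt : ℝ) / 2 ^ (m + m) = 2 * ((wt : ℝ) / 2 ^ (m + m)) := by ring
    rw [this]
    linarith [key]

end Summit.QuantumAdvantage.QuantumAdvantage.Theorems.CubicForrelation.NearExactIsExact
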